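import Literature.LinearAlgebra.Matrix.CyclotomicIntegerMatrixClasses
import Mathlib.NumberTheory.NumberField.Cyclotomic.PID
import HarnessLib

/-!
# The elements of prime-power order `p^{k+1}` of `GL_{φ(p^{k+1})}(ℤ)`: exactly `h(ℚ(ζ_{p^{k+1}}))` conjugacy classes;
# class number one: ONE class of elements of order `3` in `GL_2(ℤ)` and of order `5` in `GL_4(ℤ)`
# (Latimer–MacDuffee 1933 / Taussky 1949 for `f = Φ_{p^{k+1}}`; Mathlib: `ℤ[ζ]` maximal, `ℤ[ζ_3]`, `ℤ[ζ_5]` principal)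

[topic LinearAlgebra/Matrix] Lane `lit-hodgefound` (Track 2 foundations library), seat p15 generation 39, row g39-#3 —
sequel of g39-#2 `CyclotomicIntegerMatrixClasses` (`#{χ_B = Φ_n}/GL(ℤ) = h(ℚ(ζ_n))`; the prime-order case).
THEOREMS ONLY (no definition, no instance, no named fact; D-0026 net Literature debt `0`; no `sorry`).

## Sources, VERBATIM

J. Brzeziński, *On two classical theorems in the theory of orders*, J. Number Theory 34 (1990) 21–32
[Brzezinski1990] (held `paper:doi-10-1016-0022-314x-90-90049-w`, p0001), **(0.1) THEOREM** (Latimer–MacDuffee 1933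
[LatimerMacduffee1933], Taussky 1949 [Taussky1949]): «Let `Λ = M_n(ℤ)` and let `S = ℤ[θ]`, where `f(θ) = 0` for a
monic separable polynomial `f ∈ ℤ[X]` of degree `n`. Then there is a one-to-one correspondence between the
`Λ* = GL_n(ℤ)`-orbits on the (ring-)embeddings of `S` into `Λ` and the ideal classes of `S`. Notice that if
`φ : S → Λ` is an embedding, then the action of `Λ*` is defined by conjugation […]. Of course, there is a bijection
between the embeddings and the solutions to `f(X) = 0` in `Λ`.»  Here `f = Φ_{p^{k+1}}`, `n = φ(p^{k+1})`,
`S = ℤ[ζ_{p^{k+1}}] = 𝒪` (Mathlib `IsCyclotomicExtension.Rat.adjoin_singleton_eq_top`), and for `p^{k+1} ∈ {3, 5}`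
the ring `S` is principal (Mathlib `IsCyclotomicExtension.Rat.three_pid`, `five_pid`), so there is ONE class — the
class-number-one case of the correspondence, as in the tree's `LatimerMacDuffee` («exactly ONE class of matrix
solutions»).

## What is formalised

* §1 `p` prime, `N = φ(p^{k+1})`: for `B ∈ M_N(ℤ)`, **`B^{p^{k+1}} = 1 ∧ B^{p^k} ≠ 1 ⟺ χ_B = Φ_{p^{k+1}}`**
  (`pow_eq_one_and_pow_ne_one_iff_charpoly_eq_cyclotomic`; `X^{p^{k+1}} − 1 = Φ_{p^{k+1}}·(X^{p^k} − 1)`, the tree's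
  `irreducible_dvd_charpoly_iff_dvd_minpoly`, and `Φ_{p^{k+1}} ∤ X^{p^k} − 1` through a primitive root), hence
  **`#{B : B^{p^{k+1}} = 1, B^{p^k} ≠ 1}/GL_N(ℤ) = h(ℚ(ζ_{p^{k+1}}))`** (`natCard_quot_conj_pow_prime_pow`) and, in the
  group `GL_N(ℤ) = (M_N(ℤ))ˣ`, **the elements of order `p^{k+1}` form exactly `h(ℚ(ζ_{p^{k+1}}))` conjugacy classes**
  (`natCard_quot_isConj_orderOf_eq_prime_pow`).
* §2 class number one (Mathlib's PID theorems): **any two elements of order `3` of `GL_2(ℤ)` are conjugate**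
  (`isConj_of_orderOf_eq_three`), any two integer `2 × 2` matrices with `χ = X² + X + 1` are `GL_2(ℤ)`-conjugate
  (`exists_isUnit_conj_of_charpoly_eq_cyclotomic_three`); **any two elements of order `5` of `GL_4(ℤ)` are
  conjugate** (`isConj_of_orderOf_eq_five`), any two integer `4 × 4` matrices with `χ = Φ_5` are `GL_4(ℤ)`-conjugate
  (`exists_isUnit_conj_of_charpoly_eq_cyclotomic_five`).

Not here: composite non-prime-power orders (an element of order `n` of `GL_{φ(n)}(ℤ)` need not have `χ = Φ_n`), other
dimensions, class numbers beyond Mathlib's `ℤ[ζ_3]`, `ℤ[ζ_5]`.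

## References
* [Brzezinski1990] J. Brzeziński, J. Number Theory 34 (1990) 21–32, (0.1) Theorem. [cite: Brzezinski1990, (0.1) Theorem, p. 21]
* [LatimerMacduffee1933] C. G. Latimer, C. C. MacDuffee, Ann. of Math. 34 (1933) 313–316.
* [Taussky1949] O. Taussky, Canad. J. Math. 1 (1949) 300–302, Thms. 1–4.
-/

noncomputable section

open scoped Classical nonZeroDivisors NumberField
open Polynomial Module Submodule

namespace Literature.LinearAlgebra.Matrix.CyclotomicIntegerMatrixClassesPrimePower

open Literature.LinearAlgebra.Matrix.CyclotomicIntegerMatrixClasses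
  (natCard_quot_conj_charpoly_cyclotomic natCard_quot_isConj_orderOf_eq_prime)

/-! ## §1 Prime-power order -/

section PrimePower

variable {p : ℕ} [hp : Fact p.Prime] {k : ℕ}

omit hp in
/-- `Φ_{p^{k+1}} ∤ X^{p^k} − 1` over `ℚ` (a primitive `p^{k+1}`-th root of unity is a root of the first, not of the
second). [cite: Brzezinski1990, (0.1) Theorem («`f` … monic separable», here `f = Φ_{p^{k+1}}`), p. 21] -/
theorem not_cyclotomic_prime_pow_dvd_X_pow_sub_one (hp' : p.Prime) :
    ¬ cyclotomic (p ^ (k + 1)) ℚ ∣ (X ^ p ^ k - 1 : ℚ[X]) := by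
  intro h
  have hn0 : p ^ (k + 1) ≠ 0 := pow_ne_zero _ hp'.ne_zero
  -- a primitive `p^{k+1}`-th root of unity in `ℂ`
  have hζ := Complex.isPrimitiveRoot_exp (p ^ (k + 1)) hn0
  set ζ := Complex.exp (2 * Real.pi * Complex.I / (p ^ (k + 1) : ℕ)) with hζdef
  have h1 : aeval ζ (cyclotomic (p ^ (k + 1)) ℚ) = 0 := by
    rw [cyclotomic_eq_minpoly_rat hζ (Nat.pos_of_ne_zero hn0), minpoly.aeval]
  have h2 : aeval ζ (X ^ p ^ k - 1 : ℚ[X]) = 0 := by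
    obtain ⟨r, hr⟩ := h
    rw [hr, map_mul, h1, zero_mul]
  rw [map_sub, map_pow, aeval_X, aeval_one, sub_eq_zero, hζ.pow_eq_one_iff_dvd] at h2
  have h3 : p ^ (k + 1) ≤ p ^ k := Nat.le_of_dvd (pow_pos hp'.pos k) h2
  exact absurd h3 (not_le.mpr (Nat.pow_lt_pow_right hp'.one_lt (Nat.lt_succ_self k)))

/-- For `B ∈ M_N(ℤ)`, `N = φ(p^{k+1})`: **`B^{p^{k+1}} = 1` and `B^{p^k} ≠ 1` iff `χ_B = Φ_{p^{k+1}}`** — for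
`f = Φ_{p^{k+1}}` and `n = φ(p^{k+1})` this identifies «the solutions to `f(X) = 0` in `Λ = M_n(ℤ)`» of the
Latimer–MacDuffee theorem with the matrices of order `p^{k+1}` (an elementary reformulation proved here: `⇒` from
`μ_B ∣ X^{p^{k+1}} − 1 = Φ_{p^{k+1}}·(X^{p^k} − 1)`, `Φ ∤ χ_B ⇒ Φ ∤ μ_B ⇒ μ_B ∣ X^{p^k} − 1`, and degrees; `⇐` by
Cayley–Hamilton and `Φ_{p^{k+1}} ∤ X^{p^k} − 1`). [cite: Brzezinski1990, (0.1) Theorem and the remark following it («there is a bijection between the embeddings and the solutions to f(X) = 0 in Λ»), p. 21] -/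
theorem pow_eq_one_and_pow_ne_one_iff_charpoly_eq_cyclotomic {N : ℕ} (hN : (p ^ (k + 1)).totient = N)
    (B : _root_.Matrix (Fin N) (Fin N) ℤ) :
    (B ^ p ^ (k + 1) = 1 ∧ B ^ p ^ k ≠ 1) ↔ B.charpoly = cyclotomic (p ^ (k + 1)) ℤ := by
  set f := Int.castRingHom ℚ with hf
  set Bq : _root_.Matrix (Fin N) (Fin N) ℚ := B.map f with hBq
  have hirr : Irreducible (cyclotomic (p ^ (k + 1)) ℚ) :=
    cyclotomic.irreducible_rat (pow_pos hp.out.pos _)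
  -- `Φ ∣ χ_{B_ℚ} ⟺ Φ ∣ μ_{B_ℚ}` (the tree's Hoffman–Kunze §7.2 Thm. 4 (ii))
  have hiff : cyclotomic (p ^ (k + 1)) ℚ ∣ Bq.charpoly ↔ cyclotomic (p ^ (k + 1)) ℚ ∣ minpoly ℚ Bq := by
    have h2 := Literature.LinearAlgebra.irreducible_dvd_charpoly_iff_dvd_minpoly (Matrix.toLin' Bq) hirr
    rwa [Matrix.charpoly_toLin', Matrix.minpoly_toLin'] at h2
  have hpow : ∀ m : ℕ, B ^ m = 1 ↔ Bq ^ m = 1 := fun m => by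
    constructor
    · intro h
      rw [hBq, ← RingHom.mapMatrix_apply, ← map_pow, h, map_one]
    · intro h
      apply Matrix.map_injective f.injective_int
      change B.map f ^ m = 1 at h
      change (B ^ m).map f = (1 : _root_.Matrix (Fin N) (Fin N) ℤ).map f
      rw [Matrix.map_one f (map_zero f) (map_one f), ← h, ← RingHom.mapMatrix_apply, ← RingHom.mapMatrix_apply,
        map_pow]
  constructor
  · rintro ⟨hB1, hB0⟩
    have hBq1 : Bq ^ p ^ (k + 1) = 1 := (hpow _).mp hB1
    have hBq0 : Bq ^ p ^ k ≠ 1 := fun h => hB0 ((hpow _).mpr h)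
    -- `μ ∣ X^{p^{k+1}} − 1 = Φ · (X^{p^k} − 1)`
    have hμ : minpoly ℚ Bq ∣ (X ^ p ^ k - 1) * cyclotomic (p ^ (k + 1)) ℚ := by
      rw [mul_comm, cyclotomic_prime_pow_mul_X_pow_sub_one]
      exact minpoly.dvd ℚ Bq (by simp [hBq1])
    -- `Φ ∣ χ`
    have hdvd : cyclotomic (p ^ (k + 1)) ℚ ∣ Bq.charpoly := by
      by_contra hnd
      have hcop : IsCoprime (minpoly ℚ Bq) (cyclotomic (p ^ (k + 1)) ℚ) :=
        (hirr.coprime_iff_not_dvd.2 fun h => hnd (hiff.2 h)).symm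
      have h3 : minpoly ℚ Bq ∣ X ^ p ^ k - 1 := hcop.dvd_of_dvd_mul_right hμ
      have h4 : aeval Bq (X ^ p ^ k - 1 : ℚ[X]) = 0 := by
        obtain ⟨r, hr⟩ := h3
        rw [hr, map_mul, minpoly.aeval, zero_mul]
      rw [map_sub, map_pow, aeval_X, aeval_one, sub_eq_zero] at h4
      exact hBq0 h4
    have heq : Bq.charpoly = cyclotomic (p ^ (k + 1)) ℚ := by
      refine Polynomial.eq_of_monic_of_dvd_of_natDegree_le (cyclotomic.monic _ ℚ) Bq.charpoly_monic hdvd ?_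
      rw [Matrix.charpoly_natDegree_eq_dim, Fintype.card_fin, natDegree_cyclotomic, hN]
    apply Polynomial.map_injective f f.injective_int
    rw [← Matrix.charpoly_map, ← hBq, heq, map_cyclotomic_int]
  · intro hB
    have hCH : aeval B (cyclotomic (p ^ (k + 1)) ℤ) = 0 := by rw [← hB]; exact Matrix.aeval_self_charpoly B
    constructor
    · have h1 : aeval B (X ^ p ^ (k + 1) - 1 : ℤ[X]) = 0 := by
        rw [← cyclotomic_prime_pow_mul_X_pow_sub_one, map_mul, hCH, zero_mul]
      rwa [map_sub, map_pow, aeval_X, aeval_one, sub_eq_zero] at h1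
    · intro h0
      -- then `μ_{B_ℚ} ∣ X^{p^k} − 1` and `Φ ∣ χ = Φ ⇒ Φ ∣ μ`, so `Φ ∣ X^{p^k} − 1`: impossible
      have hBq0 : Bq ^ p ^ k = 1 := (hpow _).mp h0
      have hμ : minpoly ℚ Bq ∣ X ^ p ^ k - 1 := minpoly.dvd ℚ Bq (by simp [hBq0])
      have hχ : Bq.charpoly = cyclotomic (p ^ (k + 1)) ℚ := by
        rw [hBq, Matrix.charpoly_map, hB, map_cyclotomic_int]
      have hΦμ : cyclotomic (p ^ (k + 1)) ℚ ∣ minpoly ℚ Bq := hiff.1 (hχ ▸ dvd_rfl)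
      exact not_cyclotomic_prime_pow_dvd_X_pow_sub_one hp.out (hΦμ.trans hμ)

/-- **`#{B ∈ M_N(ℤ) : B^{p^{k+1}} = 1, B^{p^k} ≠ 1}/GL_N(ℤ) = h(ℚ(ζ_{p^{k+1}}))`** for `N = φ(p^{k+1})` and any
cyclotomic field `K = ℚ(ζ_{p^{k+1}})` (g39-#2's count of the matrices with `χ = Φ_{p^{k+1}}` and §1).
[cite: Brzezinski1990, (0.1) Theorem (with `f = Φ_{p^{k+1}}`), p. 21] [cite: Taussky1949, Thms. 1–4] -/
theorem natCard_quot_conj_pow_prime_pow {N : ℕ} (hN : (p ^ (k + 1)).totient = N) (K : Type) [Field K]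
    [NumberField K] [IsCyclotomicExtension {p ^ (k + 1)} ℚ K] :
    Nat.card (Quot (fun B B' : {B : _root_.Matrix (Fin N) (Fin N) ℤ // B ^ p ^ (k + 1) = 1 ∧ B ^ p ^ k ≠ 1} =>
        ∃ Q : _root_.Matrix (Fin N) (Fin N) ℤ, IsUnit Q.det ∧ Q * B.1 = B'.1 * Q)) =
      Fintype.card (ClassGroup (𝓞 K)) := by
  haveI : NeZero (p ^ (k + 1)) := ⟨pow_ne_zero _ hp.out.ne_zero⟩
  rw [← natCard_quot_conj_charpoly_cyclotomic K hN]
  set rC := (fun B B' : {B : _root_.Matrix (Fin N) (Fin N) ℤ // B.charpoly = cyclotomic (p ^ (k + 1)) ℤ} =>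
    ∃ Q : _root_.Matrix (Fin N) (Fin N) ℤ, IsUnit Q.det ∧ Q * B.1 = B'.1 * Q) with hrC
  let e : {B : _root_.Matrix (Fin N) (Fin N) ℤ // B ^ p ^ (k + 1) = 1 ∧ B ^ p ^ k ≠ 1} ≃
      {B : _root_.Matrix (Fin N) (Fin N) ℤ // B.charpoly = cyclotomic (p ^ (k + 1)) ℤ} :=
    Equiv.subtypeEquivRight fun B => pow_eq_one_and_pow_ne_one_iff_charpoly_eq_cyclotomic hN B
  exact Nat.card_congr (Quot.congr (rb := rC) e fun B B' => Iff.rfl)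

omit hp in
/-- `orderOf x = p^{k+1}` iff `x^{p^{k+1}} = 1` and `x^{p^k} ≠ 1` (in any monoid, `p` prime). [cite: Brzezinski1990, (0.1) Theorem (the orders of the solutions of `Φ_{p^{k+1}}(X) = 0`), p. 21] -/
theorem orderOf_eq_prime_pow_iff {M : Type*} [Monoid M] (hp' : p.Prime) (x : M) :
    orderOf x = p ^ (k + 1) ↔ x ^ p ^ (k + 1) = 1 ∧ x ^ p ^ k ≠ 1 := by
  haveI : Fact p.Prime := ⟨hp'⟩
  constructor
  · intro h
    refine ⟨by rw [← h]; exact pow_orderOf_eq_one x, fun h0 => ?_⟩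
    have h1 : p ^ (k + 1) ∣ p ^ k := h ▸ orderOf_dvd_of_pow_eq_one h0
    exact absurd (Nat.le_of_dvd (pow_pos hp'.pos k) h1)
      (not_le.mpr (Nat.pow_lt_pow_right hp'.one_lt (Nat.lt_succ_self k)))
  · rintro ⟨h1, h0⟩
    exact orderOf_eq_prime_pow h0 h1

/-- **In the group `GL_N(ℤ) = (M_N(ℤ))ˣ`, `N = φ(p^{k+1})`, the elements of order `p^{k+1}` form exactly
`h(ℚ(ζ_{p^{k+1}}))` conjugacy classes** (`IsConj`; Latimer–MacDuffee–Taussky for `f = Φ_{p^{k+1}}`, `ℤ[ζ]` maximal).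
[cite: Brzezinski1990, (0.1) Theorem (with `f = Φ_{p^{k+1}}`, `n = φ(p^{k+1})`: «the `Λ* = GL_n(ℤ)`-orbits … the action of `Λ*` is defined by conjugation»), p. 21] [cite: Taussky1949, Thms. 1–4] -/
theorem natCard_quot_isConj_orderOf_eq_prime_pow {N : ℕ} (hN : (p ^ (k + 1)).totient = N) (K : Type) [Field K]
    [NumberField K] [IsCyclotomicExtension {p ^ (k + 1)} ℚ K] :
    Nat.card (Quot (fun g g' : {g : (_root_.Matrix (Fin N) (Fin N) ℤ)ˣ // orderOf g = p ^ (k + 1)} =>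
        IsConj g.1 g'.1)) =
      Fintype.card (ClassGroup (𝓞 K)) := by
  rw [← natCard_quot_conj_pow_prime_pow hN K]
  set rP := (fun B B' : {B : _root_.Matrix (Fin N) (Fin N) ℤ // B ^ p ^ (k + 1) = 1 ∧ B ^ p ^ k ≠ 1} =>
    ∃ Q : _root_.Matrix (Fin N) (Fin N) ℤ, IsUnit Q.det ∧ Q * B.1 = B'.1 * Q) with hrP
  have hord : ∀ g : (_root_.Matrix (Fin N) (Fin N) ℤ)ˣ,
      orderOf g = p ^ (k + 1) ↔ (g : _root_.Matrix (Fin N) (Fin N) ℤ) ^ p ^ (k + 1) = 1 ∧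
        (g : _root_.Matrix (Fin N) (Fin N) ℤ) ^ p ^ k ≠ 1 := fun g => by
    rw [← orderOf_units, orderOf_eq_prime_pow_iff hp.out]
  have hunit : ∀ B : {B : _root_.Matrix (Fin N) (Fin N) ℤ // B ^ p ^ (k + 1) = 1 ∧ B ^ p ^ k ≠ 1},
      IsUnit B.1 := fun B => IsUnit.of_pow_eq_one B.2.1 (pow_ne_zero _ hp.out.ne_zero)
  let e : {g : (_root_.Matrix (Fin N) (Fin N) ℤ)ˣ // orderOf g = p ^ (k + 1)} ≃
      {B : _root_.Matrix (Fin N) (Fin N) ℤ // B ^ p ^ (k + 1) = 1 ∧ B ^ p ^ k ≠ 1} :=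
    { toFun := fun g => ⟨(g.1 : _root_.Matrix (Fin N) (Fin N) ℤ), (hord g.1).mp g.2⟩
      invFun := fun B => ⟨(hunit B).unit, (hord _).mpr (by rw [IsUnit.unit_spec]; exact B.2)⟩
      left_inv := fun g => Subtype.ext (Units.ext
        (hunit ⟨(g.1 : _root_.Matrix (Fin N) (Fin N) ℤ), (hord g.1).mp g.2⟩).unit_spec)
      right_inv := fun B => Subtype.ext (hunit B).unit_spec }
  refine Nat.card_congr (Quot.congr (rb := rP) e fun g g' => ?_)
  change IsConj g.1 g'.1 ↔ ∃ Q : _root_.Matrix (Fin N) (Fin N) ℤ, IsUnit Q.det ∧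
    Q * (g.1 : _root_.Matrix (Fin N) (Fin N) ℤ) = (g'.1 : _root_.Matrix (Fin N) (Fin N) ℤ) * Q
  rw [isConj_iff]
  constructor
  · rintro ⟨c, hc⟩
    refine ⟨(c : _root_.Matrix (Fin N) (Fin N) ℤ), (Matrix.isUnit_iff_isUnit_det _).mp c.isUnit, ?_⟩
    rw [mul_inv_eq_iff_eq_mul] at hc
    have := congrArg Units.val hc
    simpa only [Units.val_mul] using this
  · rintro ⟨Q, hQ, hQg⟩
    have hQu : IsUnit Q := (Matrix.isUnit_iff_isUnit_det Q).mpr hQ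
    refine ⟨hQu.unit, ?_⟩
    rw [mul_inv_eq_iff_eq_mul]
    apply Units.ext
    simp only [Units.val_mul, IsUnit.unit_spec]
    exact hQg

end PrimePower

/-! ## §2 Class number one: `GL_2(ℤ)` order `3`, `GL_4(ℤ)` order `5` -/

section ClassNumberOne

/-- From `Nat.card (Quot r) = 1` for an equivalence relation `r`: any two elements are related. [folklore] -/
private theorem rel_of_natCard_quot_eq_one {α : Type*} {r : α → α → Prop} (hr : Equivalence r)
    (h : Nat.card (Quot r) = 1) (a b : α) : r a b := by
  have hsub : Subsingleton (Quot r) := (Nat.card_eq_one_iff_unique.mp h).1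
  exact hr.eqvGen_iff.mp (Quot.eqvGen_exact (Subsingleton.elim (Quot.mk r a) (Quot.mk r b)))

/-- `IsConj` pulled back to a subtype of a monoid is an equivalence relation. [folklore] -/
private theorem equivalence_isConj_subtype {M : Type*} [Monoid M] (P : M → Prop) :
    Equivalence (fun g g' : {g : M // P g} => IsConj g.1 g'.1) :=
  ⟨fun g => IsConj.refl g.1, fun h => IsConj.symm h, fun h1 h2 => IsConj.trans h1 h2⟩

/-- The relation `∃ Q ∈ GL_N(ℤ), QB = B′Q` pulled back to a subtype of `M_N(ℤ)` is an equivalence relation.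
[folklore] -/
private theorem equivalence_conj_subtype {N : ℕ} (P : _root_.Matrix (Fin N) (Fin N) ℤ → Prop) :
    Equivalence (fun B B' : {B : _root_.Matrix (Fin N) (Fin N) ℤ // P B} =>
      ∃ Q : _root_.Matrix (Fin N) (Fin N) ℤ, IsUnit Q.det ∧ Q * B.1 = B'.1 * Q) := by
  refine ⟨fun B => ⟨1, by simp⟩, ?_, ?_⟩
  · rintro B B' ⟨Q, hQ, h⟩
    obtain ⟨u, rfl⟩ := (Matrix.isUnit_iff_isUnit_det Q).mpr hQ
    refine ⟨((u⁻¹ : (_root_.Matrix (Fin N) (Fin N) ℤ)ˣ) : _root_.Matrix (Fin N) (Fin N) ℤ),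
      (Matrix.isUnit_iff_isUnit_det _).mp (Units.isUnit _), ?_⟩
    calc ((u⁻¹ : (_root_.Matrix (Fin N) (Fin N) ℤ)ˣ) : _root_.Matrix (Fin N) (Fin N) ℤ) * B'.1
        = ↑u⁻¹ * B'.1 * (↑u * ↑u⁻¹) := by rw [Units.mul_inv, mul_one]
      _ = ↑u⁻¹ * (B'.1 * ↑u) * ↑u⁻¹ := by simp only [mul_assoc]
      _ = ↑u⁻¹ * (↑u * B.1) * ↑u⁻¹ := by rw [h]
      _ = ↑u⁻¹ * ↑u * B.1 * ↑u⁻¹ := by simp only [mul_assoc]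
      _ = B.1 * ↑u⁻¹ := by rw [Units.inv_mul, one_mul]
  · rintro B B' B'' ⟨Q, hQ, h⟩ ⟨Q', hQ', h'⟩
    refine ⟨Q' * Q, ?_, ?_⟩
    · rw [Matrix.det_mul]; exact hQ'.mul hQ
    · rw [mul_assoc, h, ← mul_assoc, h', mul_assoc]

-- Mathlib's own device for `CyclotomicField n ℚ` (the `ℚ`-algebra instance of the splitting field vs `algebraRat`,
-- cf. `fermatLastTheoremThree`): unfold instances when unifying.
set_option backward.isDefEq.respectTransparency false in
/-- **Any two elements of order `3` of `GL_2(ℤ)` are conjugate** — there is exactly ONE conjugacy class, because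
`h(ℚ(ζ_3)) = 1` (`ℤ[ζ_3]` is principal, Mathlib `IsCyclotomicExtension.Rat.three_pid`): the class-number-one case of
the Latimer–MacDuffee–Taussky correspondence for `f = Φ_3 = X² + X + 1`. [cite: Brzezinski1990, (0.1) Theorem (with `f = Φ_3`, `n = 2`, `S = ℤ[ζ_3]` principal), p. 21] [cite: Taussky1949, Thms. 1–4] -/
theorem isConj_of_orderOf_eq_three (g g' : (_root_.Matrix (Fin 2) (Fin 2) ℤ)ˣ) (hg : orderOf g = 3)
    (hg' : orderOf g' = 3) : IsConj g g' := by
  haveI : Fact (Nat.Prime 3) := ⟨Nat.prime_three⟩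
  have hcard := natCard_quot_isConj_orderOf_eq_prime (p := 3) (CyclotomicField 3 ℚ)
  rw [card_classGroup_eq_one_iff.mpr (IsCyclotomicExtension.Rat.three_pid (CyclotomicField 3 ℚ))] at hcard
  exact rel_of_natCard_quot_eq_one (equivalence_isConj_subtype _) hcard ⟨g, hg⟩ ⟨g', hg'⟩

-- Mathlib's own device for `CyclotomicField n ℚ` (the `ℚ`-algebra instance of the splitting field vs `algebraRat`,
-- cf. `fermatLastTheoremThree`): unfold instances when unifying.
set_option backward.isDefEq.respectTransparency false in
/-- **Any two integer `2 × 2` matrices with characteristic polynomial `X² + X + 1 = Φ_3` are conjugate by an element of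
`GL_2(ℤ)`** (one class: `h(ℚ(ζ_3)) = 1`). [cite: Brzezinski1990, (0.1) Theorem (with `f = Φ_3`, `S = ℤ[ζ_3]` principal), p. 21] [cite: Taussky1949, Thms. 1–4] -/
theorem exists_isUnit_conj_of_charpoly_eq_cyclotomic_three (B B' : _root_.Matrix (Fin 2) (Fin 2) ℤ)
    (hB : B.charpoly = X ^ 2 + X + 1) (hB' : B'.charpoly = X ^ 2 + X + 1) :
    ∃ Q : _root_.Matrix (Fin 2) (Fin 2) ℤ, IsUnit Q.det ∧ Q * B = B' * Q := by
  haveI : Fact (Nat.Prime 3) := ⟨Nat.prime_three⟩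
  rw [← Polynomial.cyclotomic_three] at hB hB'
  have hcard := natCard_quot_conj_charpoly_cyclotomic (n := 3) (CyclotomicField 3 ℚ)
    (Nat.totient_prime Nat.prime_three)
  rw [card_classGroup_eq_one_iff.mpr (IsCyclotomicExtension.Rat.three_pid (CyclotomicField 3 ℚ))] at hcard
  exact rel_of_natCard_quot_eq_one (equivalence_conj_subtype _) hcard ⟨B, hB⟩ ⟨B', hB'⟩

-- Mathlib's own device for `CyclotomicField n ℚ` (the `ℚ`-algebra instance of the splitting field vs `algebraRat`,
-- cf. `fermatLastTheoremThree`): unfold instances when unifying.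
set_option backward.isDefEq.respectTransparency false in
/-- **Any two elements of order `5` of `GL_4(ℤ)` are conjugate** — one conjugacy class, because `h(ℚ(ζ_5)) = 1`
(`ℤ[ζ_5]` is principal, Mathlib `IsCyclotomicExtension.Rat.five_pid`). [cite: Brzezinski1990, (0.1) Theorem (with `f = Φ_5`, `n = 4`, `S = ℤ[ζ_5]` principal), p. 21] [cite: Taussky1949, Thms. 1–4] -/
theorem isConj_of_orderOf_eq_five (g g' : (_root_.Matrix (Fin 4) (Fin 4) ℤ)ˣ) (hg : orderOf g = 5)
    (hg' : orderOf g' = 5) : IsConj g g' := by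
  haveI : Fact (Nat.Prime 5) := ⟨Nat.prime_five⟩
  have hcard := natCard_quot_isConj_orderOf_eq_prime (p := 5) (CyclotomicField 5 ℚ)
  rw [card_classGroup_eq_one_iff.mpr (IsCyclotomicExtension.Rat.five_pid (CyclotomicField 5 ℚ))] at hcard
  exact rel_of_natCard_quot_eq_one (equivalence_isConj_subtype _) hcard ⟨g, hg⟩ ⟨g', hg'⟩

-- Mathlib's own device for `CyclotomicField n ℚ` (the `ℚ`-algebra instance of the splitting field vs `algebraRat`,
-- cf. `fermatLastTheoremThree`): unfold instances when unifying.
set_option backward.isDefEq.respectTransparency false in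
/-- **Any two integer `4 × 4` matrices with characteristic polynomial `Φ_5 = X⁴ + X³ + X² + X + 1` are conjugate by
an element of `GL_4(ℤ)`** (one class: `h(ℚ(ζ_5)) = 1`). [cite: Brzezinski1990, (0.1) Theorem (with `f = Φ_5`, `S = ℤ[ζ_5]` principal), p. 21] [cite: Taussky1949, Thms. 1–4] -/
theorem exists_isUnit_conj_of_charpoly_eq_cyclotomic_five (B B' : _root_.Matrix (Fin 4) (Fin 4) ℤ)
    (hB : B.charpoly = cyclotomic 5 ℤ) (hB' : B'.charpoly = cyclotomic 5 ℤ) :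
    ∃ Q : _root_.Matrix (Fin 4) (Fin 4) ℤ, IsUnit Q.det ∧ Q * B = B' * Q := by
  haveI : Fact (Nat.Prime 5) := ⟨Nat.prime_five⟩
  have hcard := natCard_quot_conj_charpoly_cyclotomic (n := 5) (CyclotomicField 5 ℚ)
    (Nat.totient_prime Nat.prime_five)
  rw [card_classGroup_eq_one_iff.mpr (IsCyclotomicExtension.Rat.five_pid (CyclotomicField 5 ℚ))] at hcard
  exact rel_of_natCard_quot_eq_one (equivalence_conj_subtype _) hcard ⟨B, hB⟩ ⟨B', hB'⟩

end ClassNumberOne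

end Literature.LinearAlgebra.Matrix.CyclotomicIntegerMatrixClassesPrimePower
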